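import Summits.QuantumFields.YangMills.Theses.XiCompleteMonotonicity
import HarnessLib

/-!
# Route `XiCompleteMonotonicity` (YangMills): the assembly item (stmt-QuantumFields-8945) holds

`AxialLogConvexity → ExponentialWindow → XiExpLowerBound` — the CHORD ARGUMENT for the axial plaquette–plaquette correlator
`a(n) = plaquetteCorrFn r.ρ μ (n e₀)` of an infinite-volume limit state: reflection positivity makes `a` non-negative,
non-increasing, bounded by `N²` and log-convex from index `1` on; the exponential window gives `a(n) ≥ A/(β² n⁸)` up to
`n ≤ e^{cβ}`.  Take `t + 1 = ⌊e^{cβ}⌋`: the ratios `a(k+1)/a(k)` increase with `k`, so `a(n) ≥ a(t) q_t^{n−t}` for `n ≥ t`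
and `a(n) ≥ a(t)` for `n ≤ t`, i.e. `a(n) ≥ a(t) e^{−mn}` with `m = log(a(t)/a(t+1)) ≥ 0`; and the chord from `1` to `t`
bounds `m ≤ (log N² − log(A/(β² e^{8cβ})))/(t − 1) ≤ K β e^{−cβ}` for `β ≥ 1`, `e^{cβ} ≥ n₀ + 6`.  The abstract sequence
lemma is `XiLogConvexChord.exp_lower_of_logConvex`.  Nothing is asserted about Yang–Mills beyond the two hypotheses; the cruxes
`AxialLogConvexity`, `ExponentialWindow` remain open; no summit statement is proved (width seat ym-t4-w17 g0, free hands; the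
item carried an unlanded refuter candidate of 2026-08-15).
-/

set_option autoImplicit false

namespace Summit.QuantumFields.YangMills.Theorems

namespace XiLogConvexChord

/-- **Exponential lower bound from log-convexity (chord argument).**  A non-negative, non-increasing sequence bounded by
`S`, log-convex from index `1` on (`a(n+2)² ≤ a(n+1)a(n+3)`), which is `≥ L > 0` at two consecutive indices `t, t+1` with
`t ≥ 2`, satisfies `a n ≥ a t · e^{−m n}` for all `n`, with a rate `0 ≤ m ≤ (log S − log L)/(t − 1)`. [folklore] -/
theorem exp_lower_of_logConvex {a : ℕ → ℝ} {S L : ℝ} {t : ℕ}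
    (h : ∀ n, 0 ≤ a n ∧ a (n + 1) ≤ a n ∧ a n ≤ S ∧ a (n + 2) ^ 2 ≤ a (n + 1) * a (n + 3))
    (ht : 2 ≤ t) (hL : 0 < L) (hLt : L ≤ a t) (hLt1 : L ≤ a (t + 1)) :
    ∃ m : ℝ, 0 ≤ m ∧ m ≤ (Real.log S - Real.log L) / ((t : ℝ) - 1) ∧ ∀ n : ℕ, a t * Real.exp (-(m * n)) ≤ a n := by
  obtain ⟨s, rfl⟩ : ∃ s, t = s + 2 := ⟨t - 2, by omega⟩
  have hanti : Antitone a := antitone_nat_of_succ_le fun n => (h n).2.1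
  -- positivity everywhere: below `t` by monotonicity, above by log-convexity
  have hpos_up : ∀ i : ℕ, 0 < a (s + 2 + i) ∧ 0 < a (s + 2 + i + 1) := by
    intro i
    induction i with
    | zero => exact ⟨hL.trans_le (by simpa using hLt), hL.trans_le (by simpa using hLt1)⟩
    | succ i ih =>
      refine ⟨by simpa [Nat.add_assoc] using ih.2, ?_⟩
      have hc := (h (s + 2 + i)).2.2.2   -- a(s+2+i+2)^2 ≤ a(s+2+i+1) * a(s+2+i+3)
      have h1 : 0 < a (s + 2 + i + 1) := ih.2
      have h2 : 0 < a (s + 2 + i + 2) ^ 2 := by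
        have := ih.2
        -- a (s+2+i+2) ≥ ... we need positivity of a(s+2+i+2): from antitone? no — use the square bound chain
        -- a(s+2+i+1)^2 ≤ a(s+2+i) a(s+2+i+2) gives it
        have hc' := (h (s + 1 + i)).2.2.2
        have e1 : s + 1 + i + 2 = s + 2 + i + 1 := by omega
        have e2 : s + 1 + i + 1 = s + 2 + i := by omega
        have e3 : s + 1 + i + 3 = s + 2 + i + 2 := by omega
        rw [e1, e2, e3] at hc'
        have hsq : 0 < a (s + 2 + i + 1) ^ 2 := by positivity
        have : 0 < a (s + 2 + i) * a (s + 2 + i + 2) := lt_of_lt_of_le hsq hc'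
        have hx : 0 < a (s + 2 + i + 2) := by
          rcases (h (s + 2 + i + 2)).1.eq_or_lt with h0 | h0
          · rw [← h0, mul_zero] at this; exact absurd this (lt_irrefl 0)
          · exact h0
        positivity
      have : 0 < a (s + 2 + i + 1) * a (s + 2 + i + 3) := lt_of_lt_of_le h2 hc
      have e4 : s + 2 + (i + 1) + 1 = s + 2 + i + 2 := by omega
      rw [e4]
      rcases (h (s + 2 + i + 2)).1.eq_or_lt with h0 | h0
      · -- a(s+2+i+2) = 0 forces a(s+2+i+2)^2 = 0 < ... fine, but we need a(s+2+i+2) > 0: use h2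
        exact absurd (by rw [← h0]; norm_num : a (s + 2 + i + 2) ^ 2 = (0:ℝ)) h2.ne'
      · exact h0
  have hpos : ∀ n, 0 < a n := by
    intro n
    by_cases hn : n ≤ s + 2
    · exact (hpos_up 0).1.trans_le (by simpa using hanti hn)
    · obtain ⟨i, rfl⟩ : ∃ i, n = s + 2 + i := ⟨n - (s + 2), by omega⟩
      exact (hpos_up i).1
  -- the ratio `q k = a(k+1)/a k` is non-decreasing from `k = 1` on and `≤ 1`
  set q : ℕ → ℝ := fun k => a (k + 1) / a k with hq
  have hq_mono : Monotone fun i => q (i + 1) := by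
    refine monotone_nat_of_le_succ fun i => ?_
    show a (i + 1 + 1) / a (i + 1) ≤ a (i + 1 + 1 + 1) / a (i + 1 + 1)
    rw [div_le_div_iff₀ (hpos _) (hpos _)]
    have hc := (h i).2.2.2
    have e1 : i + 1 + 1 = i + 2 := by omega
    have e2 : i + 1 + 1 + 1 = i + 3 := by omega
    rw [e1, e2]; nlinarith [hc]
  have hq_pos : ∀ k, 0 < q k := fun k => div_pos (hpos _) (hpos _)
  have hq_le_one : ∀ k, q k ≤ 1 := fun k => (div_le_one (hpos k)).mpr (h k).2.1
  -- the rate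
  set m : ℝ := Real.log (a (s + 2) / a (s + 2 + 1)) with hm
  have hqt : q (s + 2) = Real.exp (-m) := by
    rw [hm, ← Real.log_inv, inv_div, Real.exp_log (hq_pos _)]
  have hm0 : 0 ≤ m := Real.log_nonneg ((one_le_div (hpos _)).mpr (h (s + 2)).2.1)
  refine ⟨m, hm0, ?_, fun n => ?_⟩
  · -- chord bound: a t ≤ a 1 · q_t^(t-1)
    have hchain : ∀ i : ℕ, i ≤ s + 1 → a (1 + i) ≤ a 1 * q (s + 2) ^ i := by
      intro i hi
      induction i with
      | zero => simp
      | succ i ih =>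
        have hi' : i ≤ s + 1 := by omega
        have hstep : a (1 + (i + 1)) = a (1 + i) * q (1 + i) := by
          show a (1 + (i + 1)) = a (1 + i) * (a (1 + i + 1) / a (1 + i))
          rw [mul_div_cancel₀ _ (hpos _).ne', show 1 + (i + 1) = 1 + i + 1 by omega]
        have hqi : q (1 + i) ≤ q (s + 2) := by
          have h' : q (i + 1) ≤ q (s + 1 + 1) := hq_mono (show i ≤ s + 1 from hi')
          rwa [add_comm i 1] at h'
        calc a (1 + (i + 1)) = a (1 + i) * q (1 + i) := hstep
          _ ≤ a 1 * q (s + 2) ^ i * q (s + 2) :=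
              mul_le_mul (ih hi') hqi (hq_pos _).le (mul_nonneg (hpos 1).le (pow_nonneg (hq_pos _).le _))
          _ = a 1 * q (s + 2) ^ (i + 1) := by ring
    have hfin := hchain (s + 1) le_rfl
    rw [show 1 + (s + 1) = s + 2 by omega, hqt, ← Real.exp_nat_mul] at hfin
    -- L ≤ a t ≤ a 1 e^{-m (s+1)} ≤ S e^{-m(s+1)}  ⇒  m (s+1) ≤ log S - log L
    have ha1 : 0 < a 1 := hpos 1
    have hS : 0 < S := ha1.trans_le (h 1).2.2.1
    have h1 : L ≤ S * Real.exp (↑(s + 1) * -m) :=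
      hLt.trans (hfin.trans (mul_le_mul_of_nonneg_right (h 1).2.2.1 (Real.exp_nonneg _)))
    have h2 : Real.log L ≤ Real.log S + ↑(s + 1) * -m := by
      have := Real.log_le_log hL h1
      rwa [Real.log_mul hS.ne' (Real.exp_ne_zero _), Real.log_exp] at this
    have hs1 : (0 : ℝ) < ((s + 2 : ℕ) : ℝ) - 1 := by push_cast; linarith
    rw [le_div_iff₀ hs1]
    push_cast at h2 ⊢
    nlinarith
  · -- the exponential lower bound
    by_cases hn : n ≤ s + 2
    · have h1 : a (s + 2) ≤ a n := hanti hn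
      have h2 : Real.exp (-(m * n)) ≤ 1 := by
        rw [Real.exp_le_one_iff]; nlinarith [hm0, (Nat.cast_nonneg n : (0:ℝ) ≤ n)]
      nlinarith [(hpos (s + 2)).le]
    · obtain ⟨i, rfl⟩ : ∃ i, n = s + 2 + i := ⟨n - (s + 2), by omega⟩
      have hgeo : ∀ j : ℕ, a (s + 2) * q (s + 2) ^ j ≤ a (s + 2 + j) := by
        intro j
        induction j with
        | zero => simp
        | succ j ih =>
          have hstep : a (s + 2 + (j + 1)) = a (s + 2 + j) * q (s + 2 + j) := by
            show a (s + 2 + (j + 1)) = a (s + 2 + j) * (a (s + 2 + j + 1) / a (s + 2 + j))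
            rw [mul_div_cancel₀ _ (hpos _).ne']
            rfl
          have hqj : q (s + 2) ≤ q (s + 2 + j) := by
            have := hq_mono (show s + 1 ≤ s + 1 + j by omega)
            simpa [show s + 1 + 1 = s + 2 by omega, show s + 1 + j + 1 = s + 2 + j by omega] using this
          rw [hstep, pow_succ, ← mul_assoc]
          exact mul_le_mul ih hqj (hq_pos _).le (hpos _).le
      have h1 := hgeo i
      rw [hqt, ← Real.exp_nat_mul] at h1
      have h2 : Real.exp (-(m * ((s + 2 + i : ℕ) : ℝ))) ≤ Real.exp ((i : ℕ) * -m) := by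
        rw [Real.exp_le_exp]; push_cast; nlinarith [hm0]
      exact (mul_le_mul_of_nonneg_left h2 (hpos _).le).trans h1


end XiLogConvexChord

open Literature.MathematicalPhysics.QuantumFieldTheory Literature.MathematicalPhysics.QuantumLattice in
/-- **Item stmt-QuantumFields-8945 `XiCompleteMonotonicity.Assembly` holds** (`AxialLogConvexity → ExponentialWindow →
XiExpLowerBound`). [folklore] -/
theorem xiCompleteMonotonicity_assembly_proof :
    Summit.QuantumFields.YangMills.Theses.XiCompleteMonotonicity.Assembly := by
  intro hALC hEW G _ _ _ _ _ _ hG r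
  obtain ⟨β₀, c, A, n₀, hc, hA, hwin⟩ := hEW G hG r
  -- constants
  set C : ℝ := 2 * |Real.log (r.N : ℝ)| + |Real.log A| + 2 + 8 * c with hC
  have hC0 : 0 ≤ C := by rw [hC]; positivity
  refine ⟨max (max β₀ 1) (Real.log ((n₀ : ℝ) + 6) / c), c, 2 * C, hc, fun β hβ μ hμ => ?_⟩
  have hβ₀ : β₀ ≤ β := le_trans (le_trans (le_max_left _ _) (le_max_left _ _)) hβ
  have hβ1 : 1 ≤ β := le_trans (le_trans (le_max_right _ _) (le_max_left _ _)) hβ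
  have hβpos : 0 < β := lt_of_lt_of_le one_pos hβ1
  have hβlog : Real.log ((n₀ : ℝ) + 6) / c ≤ β := le_trans (le_max_right _ _) hβ
  -- the scale `e = e^{cβ} ≥ n₀ + 6`
  set e : ℝ := Real.exp (c * β) with he
  have he0 : 0 < e := Real.exp_pos _
  have he6 : (n₀ : ℝ) + 6 ≤ e := by
    have h1 : Real.log ((n₀ : ℝ) + 6) ≤ c * β := by
      rw [div_le_iff₀ hc] at hβlog; linarith [mul_comm β c]
    have h2 := Real.exp_le_exp.mpr h1
    rwa [Real.exp_log (by positivity)] at h2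
  -- the sequence and its properties
  set a : ℕ → ℝ := fun n => plaquetteCorrFn r.ρ μ ((n : ℤ) • Pi.single (0 : Fin 4) (1 : ℤ)) with ha
  have hseq : ∀ n, 0 ≤ a n ∧ a (n + 1) ≤ a n ∧ a n ≤ ((r.N : ℝ)) ^ 2 ∧ a (n + 2) ^ 2 ≤ a (n + 1) * a (n + 3) :=
    fun n => hALC G hG r β hβpos.le μ hμ n
  -- the turning index `t = ⌊e⌋ − 1`
  obtain ⟨t, htdef⟩ : ∃ t : ℕ, t + 1 = ⌊e⌋₊ := ⟨⌊e⌋₊ - 1, by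
    have : n₀ + 6 ≤ ⌊e⌋₊ := Nat.le_floor (by exact_mod_cast he6)
    omega⟩
  have hfl : n₀ + 6 ≤ t + 1 := by rw [htdef]; exact Nat.le_floor (by exact_mod_cast he6)
  have ht2 : 2 ≤ t := by omega
  have htn₀ : n₀ ≤ t := by omega
  have ht1e : ((t + 1 : ℕ) : ℝ) ≤ e := by rw [htdef]; exact Nat.floor_le he0.le
  have hte : (t : ℝ) ≤ e := le_trans (by exact_mod_cast Nat.le_succ t) ht1e
  have htm1 : e / 2 ≤ (t : ℝ) - 1 := by
    have h1 : e < (⌊e⌋₊ : ℝ) + 1 := Nat.lt_floor_add_one e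
    rw [← htdef] at h1; push_cast at h1
    have : (6 : ℝ) ≤ e := le_trans (by have := (Nat.cast_nonneg n₀ : (0:ℝ) ≤ n₀); linarith) he6
    linarith
  -- the window bound at `t` and `t+1`
  set L : ℝ := A / (β ^ 2 * e ^ 8) with hL
  have hL0 : 0 < L := by rw [hL]; positivity
  have hwinL : ∀ n : ℕ, n₀ ≤ n → 1 ≤ n → (n : ℝ) ≤ e → L ≤ a n := by
    intro n hn hn1' hne
    have h1 := hwin β hβ₀ μ hμ n hn hne
    have hn1 : (1 : ℝ) ≤ n := by exact_mod_cast hn1'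
    have hn8 : (n : ℝ) ^ 8 ≤ e ^ 8 := pow_le_pow_left₀ (by positivity) hne 8
    have hnpos : 0 < (n : ℝ) ^ 8 := by positivity
    calc L = A / (β ^ 2 * e ^ 8) := hL
      _ ≤ A / (β ^ 2 * (n : ℝ) ^ 8) := by
          apply div_le_div_of_nonneg_left hA.le (by positivity)
          exact mul_le_mul_of_nonneg_left hn8 (by positivity)
      _ ≤ a n := h1
  have hLt : L ≤ a t := hwinL t htn₀ (by omega) hte
  have hLt1 : L ≤ a (t + 1) := hwinL (t + 1) (by omega) (by omega) ht1e
  -- the chord lemma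
  obtain ⟨m, hm0, hmle, hlow⟩ := XiLogConvexChord.exp_lower_of_logConvex hseq ht2 hL0 hLt hLt1
  refine ⟨m, a t, hL0.trans_le hLt, hm0, ?_, fun n => hlow n⟩
  -- the rate bound `m ≤ 2C β e^{−cβ}`
  have hS : Real.log (((r.N : ℝ)) ^ 2) ≤ 2 * |Real.log (r.N : ℝ)| := by
    rw [Real.log_pow]; push_cast; linarith [le_abs_self (Real.log (r.N : ℝ))]
  have hlogL : Real.log L = Real.log A - 2 * Real.log β - 8 * (c * β) := by
    rw [hL, Real.log_div hA.ne' (by positivity), Real.log_mul (by positivity) (by positivity), Real.log_pow,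
      Real.log_pow, he, Real.log_exp]
    push_cast; ring
  have hlogβ : Real.log β ≤ β := (Real.log_le_sub_one_of_pos hβpos).trans (by linarith)
  have hnum : Real.log (((r.N : ℝ)) ^ 2) - Real.log L ≤ C * β := by
    rw [hlogL, hC]
    have h1 : -Real.log A ≤ |Real.log A| := neg_le_abs _
    have h2 : -Real.log A ≤ |Real.log A| * β := h1.trans (le_mul_of_one_le_right (abs_nonneg _) hβ1)
    have h3 : 2 * |Real.log (r.N : ℝ)| ≤ 2 * |Real.log (r.N : ℝ)| * β :=
      le_mul_of_one_le_right (by positivity) hβ1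
    nlinarith [hS, hlogβ, h2, h3, hβ1, hc]
  have hden : 0 < (t : ℝ) - 1 := lt_of_lt_of_le (by positivity) htm1
  calc m ≤ (Real.log (((r.N : ℝ)) ^ 2) - Real.log L) / ((t : ℝ) - 1) := hmle
    _ ≤ (C * β) / ((t : ℝ) - 1) := div_le_div_of_nonneg_right hnum hden.le
    _ ≤ (C * β) / (e / 2) := div_le_div_of_nonneg_left (by positivity) (by positivity) htm1
    _ = 2 * C * β * Real.exp (-(c * β)) := by
        rw [he, Real.exp_neg]; field_simp

end Summit.QuantumFields.YangMills.Theorems
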